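import Literature.AlgebraicGeometry.Motives.OsculatingLineMultiplicity
import Literature.RingTheory.MvPolynomial.TwoPointLineChains
import HarnessLib

/-!
# A tangent line meets the cubic in its point of contact with multiplicity two

R. Mboro, *Remarks on the `CH₂` of cubic hypersurfaces* (arXiv:1701.04488), proof of Thm. 1.3
(p. 8): the lines `l_{(x,v)}` of `ℙⁿ⁺¹` determined by a point `x` of the cubic `X` and a tangent
vector `v ∈ T_{X,x}` meet `X` at `x` with multiplicity `2` and at one residual point ("the residual
point to `x` (`x` has multiplicity `2`) in the intersection `X ∩ l_{(x,v)}`"). This file proves the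
corresponding identity of intersection CYCLES on `ℙᴺ_K` over an arbitrary infinite field `K` (in
the application `K = k(S)` is the function field of a surface `S ⊆ X` and the line is the tangent
`K`-line through its generic point `[x]` and a point `[y]` of a plane of `X`):

* `ProjSpace.eval_add_smul_eq_of_coeff_two` — the expansion along a line through a point `x` of
  the cubic: if `F(x) = 0` and the coefficient of `s²` of `F(s x + y) ∈ K[y][s]` (the differential
  of `F` at `x`, a linear form) vanishes at `r`, then `F(s x + t r) = t³ F(r) + s t² Q(r)` with `Q`
  the coefficient of `s` (a quadratic form); so for `r` on `X` the line `[x][r]` is tangent to `X`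
  at `[x]` — `F(s x + t r) = Q(r) · s t²` — and lies on `X` when moreover `Q(r) = 0`;
* `ProjSpace.exists_ne_zero_eval_eq_zero_of_isHomogeneous_one` — a linear form has a non-zero
  zero on any subspace of dimension `≥ 2` (a tangent direction inside a plane);
* `ProjSpace.primeInter_formDivisor_line_eq_two_smul_add` — **for a cubic form `F` with
  `F(s x + t y) = c · s t²`, `c ≠ 0` (the line `[x][y]` is tangent to `V₊(F)` at `[x]`, not on it,
  with residual point `[y]`): `V₊(F) · [V₊(μ)] = 2 · [[x]] + [[y]]`** as cycles on `ℙᴺ_K`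
  (`F ≡ c' ν λ² mod 𝔭_{V₊(μ)}` for linear `λ, ν` with `λ(x) = 0 ≠ λ(y)`, `ν(y) = 0 ≠ ν(x)`, so
  `V₊(F) · [V₊(μ)] = V₊(c'ν) · [V₊(μ)] + 2 V₊(λ) · [V₊(μ)]` by `primeInter_formDivisor_congr` /
  `primeInter_formDivisor_mul` of `Motives/HypersurfaceSplitLinearSections`, and each hyperplane
  meets the line in one reduced point, `primeInter_formDivisor_linear_line_eq_primeCycle`).

Everything is proved; no named facts.

## References

* [Mboro2018] R. Mboro, Remarks on the CH₂ of cubic hypersurfaces, Geom. Dedicata 200 (2018) =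
  arXiv:1701.04488, Lemma 1.1 (p. 6) and proof of Thm. 1.3 (p. 8).
* [Fulton1998] W. Fulton, Intersection Theory, 2nd ed. (1998), Def. 2.3, Prop. 2.3 (b),
  Example 2.5.1.
-/

noncomputable section

open CategoryTheory AlgebraicGeometry Order MvPolynomial
open Literature.AlgebraicGeometry.Motives.Segre

universe u

namespace Literature.AlgebraicGeometry.Motives

attribute [local instance] MvPolynomial.gradedAlgebra

namespace ProjSpace

open ProjFamily ProjectiveSpace ProjectiveSpaceCells Literature.RingTheory.MvPolynomial

variable {K : Type u} [Field K] {N : ℕ}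

/-! ### The expansion of a cubic along a line through one of its points -/

/-- **`F(s x + t r) = t³ F(r) + s t² Q(r)` when `F(x) = 0` and the differential of `F` at `x`
vanishes at `r`** (`Q`, resp. the differential, is the coefficient of `s`, resp. `s²`, of the cubic
`F(s x + y) ∈ K[y][s]`; Mboro, Lemma 1.1: "the restriction of `f` to `l` writes
`Σ μⁱ λ^{d-i} f_{d-i}(Y)`"). In particular, for `r` on `V₊(F)` the line `[x][r]` is tangent to
`V₊(F)` at `[x]` (`F(s x + t r) = Q(r) s t²`). [cite: Mboro2018, Lemma 1.1 (arXiv:1701.04488, p. 6)] -/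
theorem eval_add_smul_eq_of_coeff_two {F : MvPolynomial (Fin (N + 1)) K} (hF : F.IsHomogeneous 3)
    {x r : Fin (N + 1) → K} (hx : eval x F = 0)
    (h2 : eval r (coeff (Finsupp.single 0 2) (linePoly x F)) = 0) (s t : K) :
    eval (s • x + t • r) F =
      t ^ 3 * eval r F + s * t ^ 2 * eval r (coeff (Finsupp.single 0 1) (linePoly x F)) := by
  classical
  let P : MvPolynomial (Fin 1) (MvPolynomial (Fin (N + 1)) K) := linePoly x F
  let P' : MvPolynomial (Fin 1) (MvPolynomial (Fin (N + 1)) K) :=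
    P - C (coeff 0 P) - X 0 * C (coeff (Finsupp.single 0 1) P)
  have hcoeffX : ∀ α : Fin 1 →₀ ℕ, coeff α (X (R := MvPolynomial (Fin (N + 1)) K) 0 *
      C (coeff (Finsupp.single 0 1) P)) =
        if α = Finsupp.single 0 1 then coeff (Finsupp.single 0 1) P else 0 := by
    intro α
    rw [mul_comm, coeff_C_mul, coeff_X]
    by_cases h : α = Finsupp.single 0 1
    · rw [if_pos h.symm, if_pos h, mul_one]
    · rw [if_neg (Ne.symm h), if_neg h, mul_zero]
  have hcoeff : ∀ α, coeff α P' =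
      if α = 0 then 0 else if α = Finsupp.single 0 1 then 0 else coeff α P := by
    intro α
    change coeff α (P - C (coeff 0 P) - X 0 * C (coeff (Finsupp.single 0 1) P)) = _
    rw [coeff_sub, coeff_sub, coeff_C, hcoeffX]
    have h10 : (Finsupp.single (0 : Fin 1) 1 : Fin 1 →₀ ℕ) ≠ 0 := by
      rw [Ne, Finsupp.single_eq_zero]; exact one_ne_zero
    by_cases h : α = 0
    · subst h
      rw [if_pos rfl, if_neg (Ne.symm h10), if_pos rfl, sub_zero, sub_self]
    · rw [if_neg (Ne.symm h), if_neg h, sub_zero]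
      by_cases h' : α = Finsupp.single 0 1
      · subst h'; rw [if_pos rfl, if_pos rfl, sub_self]
      · rw [if_neg h', if_neg h', sub_zero]
  have hbi : ∀ α, (coeff α P').IsHomogeneous (3 - α.degree) ∧ (3 < α.degree → coeff α P' = 0) := by
    intro α
    rw [hcoeff]
    split_ifs with h h'
    · exact ⟨isHomogeneous_zero _ _ _, fun _ => rfl⟩
    · exact ⟨isHomogeneous_zero _ _ _, fun _ => rfl⟩
    · exact isBihom_linePoly x hF α
  have hv : ∀ α ∈ P'.support, α.degree < 3 → eval r (coeff α P') = 0 := by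
    intro α _ hα
    rw [hcoeff]
    split_ifs with h h'
    · exact map_zero _
    · exact map_zero _
    · obtain ⟨n, rfl⟩ : ∃ n, α = Finsupp.single 0 n := ⟨_, finsupp_fin_one_eq_single α⟩
      rw [Finsupp.degree_single] at hα
      have hn0 : n ≠ 0 := by rintro rfl; exact h (by rw [Finsupp.single_zero])
      have hn1 : n ≠ 1 := by rintro rfl; exact h' rfl
      interval_cases n
      · exact absurd rfl hn0
      · exact absurd rfl hn1
      · exact h2
  have key := eval_eval_smul_eq_of_isBihom_of_degree hbi hv (fun _ => s) t
  -- evaluate both sides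
  have hQ2 : (coeff (Finsupp.single 0 1) P).IsHomogeneous 2 := by
    have h := (isBihom_linePoly x hF (Finsupp.single 0 1)).1
    rwa [Finsupp.degree_single] at h
  have hev : ∀ v : Fin (N + 1) → K, eval v (eval (fun _ => C s) P') =
      eval (s • x + v) F - eval v F - s * eval v (coeff (Finsupp.single 0 1) P) := by
    intro v
    simp only [P', P, map_sub, map_mul, eval_X, eval_C, eval_eval_linePoly, eval_coeff_zero_linePoly]
  have e1 : eval (t • r) (eval (fun _ => C s) P') =
      eval (s • x + t • r) F - t ^ 3 * eval r F - s * (t ^ 2 * eval r (coeff (Finsupp.single 0 1) P)) := by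
    rw [hev, eval_smul_of_isHomogeneous hF, eval_smul_of_isHomogeneous hQ2]
  have e2 : eval (0 : Fin (N + 1) → K) (eval (fun _ => C s) P') = 0 := by
    rw [hev, add_zero, eval_smul_of_isHomogeneous hF, hx, mul_zero,
      show (0 : Fin (N + 1) → K) = (0 : K) • r from (zero_smul K r).symm,
      eval_smul_of_isHomogeneous hF, eval_smul_of_isHomogeneous hQ2, zero_pow three_ne_zero,
      zero_pow two_ne_zero, zero_mul, zero_mul, mul_zero, sub_zero, sub_zero]
  rw [e1, e2] at key
  linear_combination key

/-! ### A tangent direction inside a plane -/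

/-- **A linear form has a non-zero zero on every subspace of dimension at least `2`** (the kernel of
a linear functional on a space of dimension `≥ 2` is non-zero): used to pick, inside a plane of the
cubic, a direction tangent to it at a given point. [folklore] -/
theorem exists_ne_zero_eval_eq_zero_of_isHomogeneous_one {L : MvPolynomial (Fin (N + 1)) K}
    (hL : L.IsHomogeneous 1) {W : Submodule K (Fin (N + 1) → K)} [FiniteDimensional K W]
    (hW : 2 ≤ Module.finrank K W) :
    ∃ v ∈ W, v ≠ 0 ∧ eval v L = 0 := by
  classical
  obtain ⟨φ, hφ⟩ := exists_linearMap_forall_eval_eq hL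
  let ψ : W →ₗ[K] K := φ.comp W.subtype
  have hker : 1 ≤ Module.finrank K (LinearMap.ker ψ) := by
    have h1 := LinearMap.finrank_range_add_finrank_ker ψ
    have h2 : Module.finrank K (LinearMap.range ψ) ≤ 1 := by
      have h := Submodule.finrank_le (LinearMap.range ψ)
      rwa [Module.finrank_self] at h
    omega
  have hne : LinearMap.ker ψ ≠ ⊥ := by
    intro h
    rw [h, finrank_bot] at hker
    exact Nat.not_succ_le_zero 0 hker
  obtain ⟨w, hwker, hw0⟩ := Submodule.exists_mem_ne_zero_of_ne_bot hne
  refine ⟨(w : Fin (N + 1) → K), w.2, fun h => hw0 (Subtype.ext h), ?_⟩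
  rw [hφ]
  exact LinearMap.mem_ker.1 hwker

/-! ### `V₊(F) · [line] = 2 [[x]] + [[y]]` for a tangent line -/

variable [Infinite K]

/-- **A tangent line meets the cubic in its point of contact with multiplicity `2` and in one
residual point** (Mboro, arXiv:1701.04488, proof of Thm. 1.3: "the residual point to `x` (`x` has
multiplicity `2`) in the intersection `X ∩ l_{(x,v)}`"), as an identity of cycles on `ℙᴺ_K`: for
independent `x, y ∈ Kᴺ⁺¹` and a cubic form `F` with `F(s x + t y) = c · s t²` for all `s, t` and
some `c ≠ 0` (the line `[x][y]` is tangent to `V₊(F)` at `[x]`, is not on `V₊(F)`, and meets it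
again at `[y]`), the intersection cycle of `V₊(F)` with the line `V₊(μ)` (`μ` its `N - 1`
equations, generating the ideal of forms vanishing on `span(x, y)`) is `2 · [[x]] + [[y]]`. Proof:
`F - c' ν λ λ ∈ (μ) = 𝔭_{V₊(μ)}` for linear `λ, ν` with `λ(x) = 0 ≠ λ(y)`, `ν(y) = 0 ≠ ν(x)` and
`c' = c / (ν(x) λ(y)²)`, so `V₊(F) · [V₊(μ)] = V₊(c'ν) · [V₊(μ)] + V₊(λ) · [V₊(μ)] + V₊(λ) · [V₊(μ)]
= [[y]] + [[x]] + [[x]]`. [cite: Mboro2018, proof of Thm. 1.3 (arXiv:1701.04488, p. 8)] [cite: Fulton1998, Def. 2.3, Prop. 2.3 (b) and Example 2.5.1] -/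
theorem primeInter_formDivisor_line_eq_two_smul_add (hN : 1 ≤ N) {x y : Fin (N + 1) → K}
    (hxy : LinearIndependent K ![x, y])
    {F : MvPolynomial (Fin (N + 1)) K} (hF : F ∈ grading (Fin (N + 1)) K 3) (hF0 : F ≠ 0)
    {c : K} (hc : c ≠ 0) (htan : ∀ s t : K, eval (s • x + t • y) F = c * s * t ^ 2)
    {μ : Fin (N - 1) → MvPolynomial (Fin (N + 1)) K} (hμli : LinearIndependent K μ)
    (hμhom : ∀ l, (μ l).IsHomogeneous 1) (hμx : ∀ l, eval x (μ l) = 0) (hμy : ∀ l, eval y (μ l) = 0)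
    (hμideal : ∀ G : MvPolynomial (Fin (N + 1)) K,
      (∀ s t : K, eval (s • x + t • y) G = 0) → G ∈ Ideal.span (Set.range μ)) :
    (formDivisor F hF hF0).primeInter (X := projectiveSpace N K)
        (linearSubspacePoint μ hμli hμhom (Nat.sub_le N 1)) =
      2 • primeCycle (pointOfVec K x (by simpa using hxy.ne_zero 0)).pt +
        primeCycle (pointOfVec K y (by simpa using hxy.ne_zero 1)).pt := by
  classical
  have hx0 : x ≠ 0 := by simpa using hxy.ne_zero 0
  have hy0 : y ≠ 0 := by simpa using hxy.ne_zero 1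
  have hyx : LinearIndependent K ![y, x] := LinearIndependent.pair_symm_iff.1 hxy
  obtain ⟨lam, hlamhom, hlamx, hlamy⟩ := exists_linearForm_eval_eq_zero_ne_zero hN hxy
  obtain ⟨nu, hnuhom, hnuy, hnux⟩ := exists_linearForm_eval_eq_zero_ne_zero hN hyx
  have hlam : lam ∈ grading (Fin (N + 1)) K 1 := (mem_homogeneousSubmodule 1 lam).2 hlamhom
  have hlam0 : lam ≠ 0 := by rintro rfl; exact hlamy (map_zero _)
  have hnu : nu ∈ grading (Fin (N + 1)) K 1 := (mem_homogeneousSubmodule 1 nu).2 hnuhom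
  have hnu0 : nu ≠ 0 := by rintro rfl; exact hnux (map_zero _)
  set w := linearSubspacePoint μ hμli hμhom (Nat.sub_le N 1) with hw
  -- the constant `c' = c / (ν(x) λ(y)²)` and the linear form `c' ν`
  set c' : K := c / (eval x nu * eval y lam ^ 2) with hc'
  have hc'0 : c' ≠ 0 := div_ne_zero hc (mul_ne_zero hnux (pow_ne_zero 2 hlamy))
  have hcnu : C c' * nu ∈ grading (Fin (N + 1)) K 1 := by
    have h := Submodule.smul_mem (grading (Fin (N + 1)) K 1) c' hnu
    rwa [smul_eq_C_mul] at h
  have hcnu0 : C c' * nu ≠ 0 := mul_ne_zero (by rwa [Ne, C_eq_zero]) hnu0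
  have hcnuy : eval y (C c' * nu) = 0 := by rw [map_mul, hnuy, mul_zero]
  have hcnux : eval x (C c' * nu) ≠ 0 := by
    rw [map_mul, eval_C]; exact mul_ne_zero hc'0 hnux
  -- `F - (c'ν)λλ` vanishes on `span(x, y)`, hence lies in `𝔭_w = (μ)`
  have hlamline : ∀ s t : K, eval (s • x + t • y) lam = t * eval y lam := by
    intro s t
    rw [eval_add_smul_of_isHomogeneous_one hlamhom, hlamx, mul_zero, zero_add]
  have hnuline : ∀ s t : K, eval (s • x + t • y) nu = s * eval x nu := by
    intro s t
    rw [eval_add_smul_of_isHomogeneous_one hnuhom, hnuy, mul_zero, add_zero]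
  have hdiff : F - C c' * nu * lam * lam ∈ ProjectiveSpectrum.asHomogeneousIdeal
      (𝒜 := MvPolynomial.homogeneousSubmodule (Fin (N + 1)) K) w := by
    change F - C c' * nu * lam * lam ∈ (ProjectiveSpectrum.asHomogeneousIdeal
      (𝒜 := MvPolynomial.homogeneousSubmodule (Fin (N + 1)) K) w).toIdeal
    rw [hw, toIdeal_linearSubspacePoint]
    refine hμideal _ fun s t => ?_
    simp only [map_sub, map_mul, eval_C, htan s t, hlamline s t, hnuline s t]
    rw [hc']
    field_simp
    ring
  -- non-membership in `𝔭_w` of `F`, `λ`, `c'ν`, `(c'ν)λ`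
  have hFy : eval (x + y) F ≠ 0 := by
    have h := htan 1 1
    rw [one_smul, one_smul] at h
    rw [h, one_pow, mul_one, mul_one]
    exact hc
  have hFw : F ∉ ProjectiveSpectrum.asHomogeneousIdeal
      (𝒜 := MvPolynomial.homogeneousSubmodule (Fin (N + 1)) K) w := by
    intro h
    have h' : F ∈ (ProjectiveSpectrum.asHomogeneousIdeal
      (𝒜 := MvPolynomial.homogeneousSubmodule (Fin (N + 1)) K) w).toIdeal := h
    rw [hw, toIdeal_linearSubspacePoint] at h'
    apply hFy
    have hv : ∀ l, eval (x + y) (μ l) = 0 := fun l => by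
      have h := eval_add_smul_of_isHomogeneous_one (hμhom l) 1 1 x y
      rw [one_smul, one_smul, hμx l, hμy l, mul_zero, add_zero] at h
      exact h
    exact eval_eq_zero_of_mem_idealSpan hv h'
  have hlamw := notMem_asHomogeneousIdeal_linearSubspacePoint_of_eval_ne_zero hμli hμhom hμy hlamy
  have hcnuw : C c' * nu ∉ ProjectiveSpectrum.asHomogeneousIdeal
      (𝒜 := MvPolynomial.homogeneousSubmodule (Fin (N + 1)) K) w := by
    intro h
    have h' : C c' * nu ∈ (ProjectiveSpectrum.asHomogeneousIdeal
      (𝒜 := MvPolynomial.homogeneousSubmodule (Fin (N + 1)) K) w).toIdeal := h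
    rw [hw, toIdeal_linearSubspacePoint] at h'
    exact hcnux (eval_eq_zero_of_mem_idealSpan hμx h')
  have hcl2x : eval (x + y) (C c' * nu * lam) ≠ 0 := by
    have h1 : eval (x + y) (C c' * nu) = eval x (C c' * nu) := by
      have h := hnuline 1 1
      rw [one_smul, one_smul, one_mul] at h
      rw [map_mul, map_mul, eval_C, eval_C, h]
    have h2 : eval (x + y) lam = eval y lam := by
      have h := hlamline 1 1
      rw [one_smul, one_smul, one_mul] at h
      exact h
    rw [map_mul, h1, h2]
    exact mul_ne_zero hcnux hlamy
  have hcl2w : C c' * nu * lam ∉ ProjectiveSpectrum.asHomogeneousIdeal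
      (𝒜 := MvPolynomial.homogeneousSubmodule (Fin (N + 1)) K) w := by
    intro h
    have h' : C c' * nu * lam ∈ (ProjectiveSpectrum.asHomogeneousIdeal
      (𝒜 := MvPolynomial.homogeneousSubmodule (Fin (N + 1)) K) w).toIdeal := h
    rw [hw, toIdeal_linearSubspacePoint] at h'
    apply hcl2x
    have hv : ∀ l, eval (x + y) (μ l) = 0 := fun l => by
      have h := eval_add_smul_of_isHomogeneous_one (hμhom l) 1 1 x y
      rw [one_smul, one_smul, hμx l, hμy l, mul_zero, add_zero] at h
      exact h
    exact eval_eq_zero_of_mem_idealSpan hv h'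
  -- `V₊(F) · [w] = V₊((c'ν)λλ) · [w] = V₊(c'ν)·[w] + V₊(λ)·[w] + V₊(λ)·[w] = [[y]] + 2 [[x]]`
  have hG : C c' * nu * lam * lam ∈ grading (Fin (N + 1)) K 3 :=
    SetLike.mul_mem_graded (SetLike.mul_mem_graded hcnu hlam) hlam
  have hG0 : C c' * nu * lam * lam ≠ 0 := mul_ne_zero (mul_ne_zero hcnu0 hlam0) hlam0
  rw [primeInter_formDivisor_congr (by norm_num) hF hF0 hG hG0 hFw hdiff,
    primeInter_formDivisor_mul (by norm_num) one_pos (SetLike.mul_mem_graded hcnu hlam)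
      (mul_ne_zero hcnu0 hlam0) hlam hlam0 hcl2w hlamw,
    primeInter_formDivisor_mul one_pos one_pos hcnu hcnu0 hlam hlam0 hcnuw hlamw,
    primeInter_formDivisor_linear_line_eq_primeCycle hN hy0 hμli hμhom hμy hμx hcnu hcnu0 hcnuy hcnux,
    primeInter_formDivisor_linear_line_eq_primeCycle hN hx0 hμli hμhom hμx hμy hlam hlam0 hlamx hlamy]
  rw [two_nsmul]
  abel

end ProjSpace

end Literature.AlgebraicGeometry.Motives

end
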